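import Summits.QuantumFields.BalabanUV.T4Continuum.Spine.NE1p.DressedSmallFieldComponentSets
import Summits.QuantumFields.BalabanUV.T4Continuum.Spine.NE1p.DressedSmallFieldComponentsWitnessLive

/-!
# T⁴ programme, spine estimate NE1′ (node O3b/H2) — WITNESS «THE SET-LABELLED END FIRES — AND NEEDS ROOM»: S41.1's
# `attachedPart_locE_le_of_coresAt_pencil_componentSets` (the crew complement of the owner's N0w: SEVERAL components per member)
# APPLIED ONCE BY NAME — a decided applier — on W53's anchored-component data with NONEMPTY SETS of ⟨component, label⟩ pairs as
# inner data, at HALF of W53's amplitude; at W53's own (tight) amplitude S41.1's (2.29) clause FAILS in kernel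

Cell `pub-balaban`, sub-cell `t4`, row NE1′ formalisation crew (`t4/formal/NE1p/LEAVES.md` row W63 ∕ DAG N29zzzn — open follow-up (iii) of the
CLOSED leaf-01 lineage, SEAT-CLOSING `HOME/CLAIMS.log` l.21310 «a decided applier of S41's set-labelled END»; INTENT + STAGED l.21727, ADDENDUM
l.21758, BOOKED typer R-T136 l.21867; X189 its read), unit `b2b-balaban-t4-ne1p-formalise-leaf-06` (gen 12); PART 1 of 2 (D1).  ADDITIVE — imports S41.1 `Spine/NE1p/DressedSmallFieldComponentSets`
(leaf-01 g13, p235144; → the owner's N0w `DressedSmallFieldComponentCount` → N0v → N0u → …) and W53.2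
`Spine/NE1p/DressedSmallFieldComponentsWitnessLive` (leaf-10 g11, p235587; → W53.1 `DressedSmallFieldComponentsWitness` p235285 → N0w + S40.1
`DressedSmallFieldInnerLink` + W45 `DressedSmallFieldFamiliesWitness` + W50.1 `DressedSmallFieldInnerLabelsWitness`) ONLY; toy DATA `def`s +
theorems; 0 `def … : Prop`, 0 cite, 0 sorry, 0 `attribute`; nothing of S41 ∕ N0w ∕ N0v ∕ W53 ∕ W45 ∕ W50 ∕ W41 ∕ W35 ∕ W33 ∕ W24 ∕ S40.1 ∕
pv22 is restated — `attachedPart_locE_le_of_coresAt_pencil_componentSets`, `link_torus'`, W53's `R₀C`∕`vC`∕`vC_pos`∕`εC`∕`εC_pos`∕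
`h229_C_eq`∕`anc₁`∕`hanchor_C`∕`hA_C`∕`htransfer_C`∕`hκR_C`∕`hrate2_C`∕`hRR_C`∕`mC`∕`mC_nonneg`∕`hinner_C`∕`JC`∕`JC_eq`∕`JC_card`, W45's
`δF`∕`κF`∕`α₆F`∕`α₆F_pos`∕`α₆F_le_one`∕`hκ_F`∕`hsmall_F`, W50.1's `RI`, W41's `budget_half`∕`dj_X₀`, W35's `cM`∕`letterMass_coreW`,
W33's `coreW`∕`N₁_coreW`∕`ctr0`∕`hroom0`∕`E1`∕`liveTable`, W24's `X₀`∕`hrate_torus`, pv22's `torus_consts`∕`K₀_four` are used BY NAME.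

WHY.  S41.1 (leaf-01 g13) typed print's «n ≥ 1 components determining one Z′_i» ([Balaban1988RGII] p. 19–20, KIND) as N0v's END at
SET-VALUED inner data: the member's inner datum is a NONEMPTY finite set `T` of ⟨component, label⟩ pairs with weight `Π_{j∈T} ε·m j`,
the member bound supplied by N0w's `memberSum_le_of_anchor` ∘ `Π(1+w) − 1 ≤ x·e^{x}`, so that N0v's (2.29) clause is charged at the
amplitude `A·e^{5R}·e^{A}`, `A := ε·e^{c₀}·Aₐ·K₀` — N0w's single-component END being the `n = 1` sub-case.  Its END
`attachedPart_locE_le_of_coresAt_pencil_componentSets` (TREE `Spine/NE1p/DressedSmallFieldComponentSets.lean` l.190) has ONE applier,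
S41.2's generic `…componentSets_inner` (which supplies `hinner`), and NO decided one; W53 (leaf-10 g11) inhabits the `n = 1` END.  Here,
on pv22's torus `tgeometry 4 N` read at both scales as the SAME torus (W53's reading: `cl := id`, `ℓ := 1`, one-cube anchor `anc₁`):
* §1 **THE AMPLITUDE MUST LEAVE ROOM**: at W53's amplitude `εC` — where N0w's (2.29) clause holds WITH EQUALITY (`h229_C_eq`) — S41.1's
  clause `e·K₀·c₁·(ε·K₀·e^{5R}·e^{ε·K₀}) ≤ 1` reads `e^{εC·K₀} ≤ 1` and **FAILS** (`h229_sets_fails_at_εC`, kernel: `εC·K₀ > 0`); at the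
  HALVED amplitude `εS := εC∕2` it reads `½·e^{εS·K₀} ≤ 1` and HOLDS (`h229_S`: `εS·K₀(64,8) = α₆F·e^{−5RI}∕2 ≤ ½`, `e^{1∕2} < 2` as a local step) — the
  set-labelled END is STRICTLY more demanding than N0w's on the same datum, by exactly the clause-free factor `e^{A}` of S41 §1;
* §2 THE INNER DATA: per member `Z′` the NONEMPTY subsets of W53's `JC Z′` (= `{Z′} × Bool`, two pairs): THREE sets — `{⟨Z′,true⟩}`,
  `{⟨Z′,false⟩}`, `{⟨Z′,true⟩, ⟨Z′,false⟩}` (`JS`, `JS_card = 3`); weights `nS Z′ T := Π_{j∈T} εS·mC j.1 j.2` (W53's `mC`, half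
  the inner currency per label);
* §3 the index of record `termsS Z` := ALL admissible set-labelled outer labels (S41.1's `hadm` WITH its member-wise NONEMPTY-SUBSET
  clause, met by `hadm_S`);
* §4 the label-indexed cores (toy DATA): one W33 core per label at the weight `cS l := (cM r∕2)·majS l`, `majS l := vC^{#W′}·Π_{x∈F}
  Π_{j ∈ p x} εS·mC j.1 j.2` — S41.1's majorant SHAPE BY CHOICE, so `hAmp_S` holds by W41's `budget_half`;
* §5 **`componentSetsEnd_fires`** — S41.1's END ONCE BY NAME with W53's suppliers `hinner_C`∕`hanchor_C`∕`hA_C`∕`htransfer_C`∕`hκR_C`∕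
  `hrate2_C`∕`hRR_C` VERBATIM, W45's `hκ_F`∕`hsmall_F`, `hlink := link_torus' 4 N` (S40.1), §1's `h229_S`, §3's `hadm_S`, §4's `hAmp_S`;
  conclusion LITERAL; closed form `≤ K₀(64,8)`.
PART 2 (`…ComponentSetsWitnessLive`, imports THIS file only): located `termsS_X₀_card = 4` (three covered + one uncovered label),
`majS_sum_X₀ = εS + εS²∕4 + vC` in closed form (the two-pair set contributes the QUADRATIC term — the `n = 2` configuration of print's
«sum over two components»), liveness `componentSetsEnd_live`.

HONEST FRAMING.  A DECIDED TOY ([folklore]; 0 sorry; 0 citations; no `def … : Prop` — the `def`s are toy DATA and one numeral): the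
cores are THEOREM-backed instances of the cell's typed FORMAT of (2.14) over row NE5's TOY frame — NOT Bałaban's (2.14) terms; «inner
datum = a nonempty set of the two labels of the member itself» is OUR toy choice at W53's reading `cl = id` (the toy does NOT model the
L-blocking closure — S44's business); (B1b) NOT claimed; `hinner` MET BY A CHOSEN weight (W53's `mC`), NOT supplied from N0u's inner
count (S41.2's business); (B3)'s amplitude clause MET because the weights are CHOSEN as S41.1's majorant — (B3-amp) stays UNPRINTED for
Bałaban's cores (GAPS G-ne9p2-5); `εC∕2`, `½`, `A∕4`, `e^{−5RI}∕64` are OUR numerals over pv22's located letters `κ₀ = 64 log 162`,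
`K₀(64,8)`, `c₁ = 64`, `ν = 9`; print's «2(L+2)⁴O(1)ε₂ ≤ ½», `e^{−(κ₁−1)}`, (2.35)–(2.39) are S41∕N0w's DISPLAYED KIND, TYPE only — no
numeral of [Balaban1988RGII] asserted as a fact about Bałaban's densities; 0 binders instantiated on Bałaban's densities; no wall item;
wall v1.8 (T4-DAG v48) does NOT move; R-t4r2-Q2 NOT met thereby; NE1′ ⇐ the named binders — NOT proved, NOT printed; spine PROVED 0∕9;
count 9 unchanged.  Rung (B)+1 on ONE finite four-torus — NOT infinite volume, NOT a mass gap, NOT OS on ℝ⁴, NOT Clay.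
HONEST DEPENDENCY: continuum YM on T⁴ ⇐ BetaPertH ∧ nine spine estimates (0/9 proved); BetaPertH ⇐ (D1) ∧ (D4) ∧ CAP+tail; G-an2-4
gates asym, D1 and NE2/3/4.
-/

noncomputable section

namespace Summit.QuantumFields.BalabanUV.T4Continuum.NE1p.DressedSmallFieldComponentSetsWitness

open Set Metric MeasureTheory Complex
open scoped BigOperators
open Literature.MathematicalPhysics.QuantumFieldTheory.Balaban1983to89
open Literature.MathematicalPhysics.QuantumFieldTheory.Balaban1983to89.B12TreeDecay (K₀ K₀_pos)
open Literature.MathematicalPhysics.QuantumFieldTheory.Balaban1983to89.B13Resummation (locE Geometry)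
open Literature.MathematicalPhysics.QuantumFieldTheory.Balaban1983to89.B13FamilySum (coveringFamilies mem_coveringFamilies)
open Literature.MathematicalPhysics.QuantumFieldTheory.Balaban1983to89.TreeLengthTorus (TPt TDom tsys torusTreeLen)
open Literature.MathematicalPhysics.QuantumFieldTheory.Balaban1983to89.TreeLengthTorusGeometry (tgeometry TTouch)
open Summit.QuantumFields.BalabanUV.T4Continuum.B13HistMeasurable (B13HistM)
open Summit.QuantumFields.BalabanUV.T4Continuum.B13HistWitness (toyFrame)
open Summit.QuantumFields.BalabanUV.T4Continuum.B13TermParamGaussianBi (BiCore)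
open Summit.QuantumFields.BalabanUV.T4Continuum.NE1p.DressedSmallFieldTorusWitness (X₀ X₀_val hrate_torus)
open Summit.QuantumFields.BalabanUV.T4Continuum.NE1p.DressedSmallFieldGeometry (torus_consts)
open Summit.QuantumFields.BalabanUV.T4Continuum.NE1p.DressedSmallFieldGeometryFaces (K₀_four)
open Summit.QuantumFields.BalabanUV.T4Continuum.NE1p.DressedSmallFieldCoresWitness (E1 liveTable norm_liveTable_le coreW N₁_coreW ctr0
  hroom0 Acst Acst_pos)
open Summit.QuantumFields.BalabanUV.T4Continuum.NE1p.DressedSmallFieldCoresMassWitness (letterMass_coreW cM cM_pos)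
open Summit.QuantumFields.BalabanUV.T4Continuum.NE1p.DressedSmallFieldDepCoresWitness (budget_half dj_X₀)
open Summit.QuantumFields.BalabanUV.T4Continuum.NE1p.DressedSmallFieldFamiliesWitness (δF κF α₆F α₆F_pos α₆F_le_one hκ_F hsmall_F)
open Summit.QuantumFields.BalabanUV.T4Continuum.NE1p.DressedSmallFieldInnerLink (link_torus')
open Summit.QuantumFields.BalabanUV.T4Continuum.NE1p.DressedSmallFieldInnerLabelsWitness (RI RI_pos)
open Summit.QuantumFields.BalabanUV.T4Continuum.NE1p.DressedSmallFieldComponentsWitness (R₀C vC vC_pos vC_le εC εC_pos h229_C_eq anc₁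
  hanchor_C hA_C htransfer_C hκR_C hrate2_C hRR_C mC mC_nonneg hinner_C JC JC_eq JC_card)
open Summit.QuantumFields.BalabanUV.T4Continuum.NE1p.DressedSmallFieldComponentSets (attachedPart_locE_le_of_coresAt_pencil_componentSets)

section Torus
variable (N : ℕ) [NeZero N]

/-! ## §1 THE AMPLITUDE MUST LEAVE ROOM: S41.1's (2.29) clause fails at W53's `εC`, holds at `εS := εC ∕ 2` -/

/-- THE SET-STEP AMPLITUDE (toy numeral): `εS := εC ∕ 2` — HALF of W53's component amplitude. [folklore] -/
def εS : ℝ := εC N / 2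

/-- `0 < εS`. [arith] -/
theorem εS_pos : 0 < εS N := by unfold εS; have := εC_pos N; positivity

/-- S41 §1's clause-free exponent at our letters: `A = εS·K₀ = α₆F·e^{−5RI}∕2 ≤ ½` (W53's `εC = α₆F∕(K₀(64,8)·e^{5RI})`, W45's
`α₆F ≤ 1`, `K₀_four`). [arith] -/
theorem εS_mul_K₀_le_half : εS N * Real.exp 0 * 1 * (tgeometry 4 N).K₀ ≤ 1 / 2 := by
  rw [K₀_four, Real.exp_zero, mul_one, mul_one]
  unfold εS εC
  have hK := K₀_pos (64 : ℝ) 8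
  have hE : 1 ≤ Real.exp (5 * RI N) := Real.one_le_exp (by linarith [RI_pos N])
  rw [show α₆F / (K₀ 64 8 * Real.exp (5 * RI N)) / 2 * K₀ 64 8 = α₆F / Real.exp (5 * RI N) / 2 by field_simp]
  have h1 : α₆F / Real.exp (5 * RI N) ≤ 1 := by
    rw [div_le_one (by positivity)]; exact α₆F_le_one.trans hE
  linarith

/-- **S41.1's (2.29) CLAUSE HOLDS AT THE HALVED AMPLITUDE**: `e·K₀·c₁·(εS·e^0·1·K₀·e^{5R}·e^{εS·e^0·1·K₀}) = ½·e^{εS·K₀} ≤ ½·e^{1∕2}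
≤ 1` (W53's `h229_C_eq`: the same product at `εC` IS `1`). [arith] -/
theorem h229_S : Real.exp 1 * (tgeometry 4 N).K₀ * (tgeometry 4 N).c₁ *
    (εS N * Real.exp 0 * 1 * (tgeometry 4 N).K₀ * Real.exp (5 * RI N) * Real.exp (εS N * Real.exp 0 * 1 * (tgeometry 4 N).K₀)) ≤ 1 := by
  have hC := h229_C_eq N
  have hA := εS_mul_K₀_le_half N
  -- `e^{1∕2} < 2` (`e < 2.72 < 4`; the tree's `…FiniteGroupFalse.exp_half_lt_two` states the same — kept as a local `have`, no restatement)
  have hexp2 : Real.exp (1 / 2) < 2 := by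
    have h : Real.exp (1 / 2) * Real.exp (1 / 2) = Real.exp 1 := by rw [← Real.exp_add]; norm_num
    have he := Real.exp_one_lt_d9
    have hp := Real.exp_pos (1 / 2 : ℝ)
    nlinarith
  have hexp : Real.exp (εS N * Real.exp 0 * 1 * (tgeometry 4 N).K₀) ≤ 2 :=
    ((Real.exp_le_exp.2 hA).trans hexp2.le)
  have hpos : 0 ≤ Real.exp 1 * (tgeometry 4 N).K₀ * (tgeometry 4 N).c₁ *
      (εS N * Real.exp 0 * 1 * (tgeometry 4 N).K₀ * Real.exp (5 * RI N)) := by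
    have := (tgeometry 4 N).K₀_nonneg; have := (tgeometry 4 N).c₁_nonneg; have := (εS_pos N).le; positivity
  have hhalf : Real.exp 1 * (tgeometry 4 N).K₀ * (tgeometry 4 N).c₁ *
      (εS N * Real.exp 0 * 1 * (tgeometry 4 N).K₀ * Real.exp (5 * RI N)) = 1 / 2 := by
    unfold εS
    rw [show Real.exp 1 * (tgeometry 4 N).K₀ * (tgeometry 4 N).c₁ * (εC N / 2 * Real.exp 0 * 1 * (tgeometry 4 N).K₀ * Real.exp (5 * RI N))
      = (Real.exp 1 * (tgeometry 4 N).K₀ * (tgeometry 4 N).c₁ * (εC N * Real.exp 0 * 1 * (tgeometry 4 N).K₀ * Real.exp (5 * RI N))) / 2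
      by ring, hC]
  calc Real.exp 1 * (tgeometry 4 N).K₀ * (tgeometry 4 N).c₁ *
        (εS N * Real.exp 0 * 1 * (tgeometry 4 N).K₀ * Real.exp (5 * RI N) * Real.exp (εS N * Real.exp 0 * 1 * (tgeometry 4 N).K₀))
      = (Real.exp 1 * (tgeometry 4 N).K₀ * (tgeometry 4 N).c₁ *
          (εS N * Real.exp 0 * 1 * (tgeometry 4 N).K₀ * Real.exp (5 * RI N))) *
          Real.exp (εS N * Real.exp 0 * 1 * (tgeometry 4 N).K₀) := by ring
    _ ≤ 1 / 2 * 2 := by rw [hhalf]; exact mul_le_mul_of_nonneg_left hexp (by norm_num)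
    _ = 1 := by norm_num

/-- **… AND FAILS AT W53's OWN AMPLITUDE** [decided, kernel]: at `ε := εC` (N0w's clause TIGHT, `h229_C_eq`) S41.1's clause reads
`1·e^{εC·K₀} ≤ 1`, false since `εC·K₀ > 0` — the set-labelled END is STRICTLY more demanding than N0w's single-component END on the
same datum, by exactly S41 §1's clause-free factor `e^{A}`. [folklore] -/
theorem h229_sets_fails_at_εC : ¬ (Real.exp 1 * (tgeometry 4 N).K₀ * (tgeometry 4 N).c₁ *
    (εC N * Real.exp 0 * 1 * (tgeometry 4 N).K₀ * Real.exp (5 * RI N) * Real.exp (εC N * Real.exp 0 * 1 * (tgeometry 4 N).K₀)) ≤ 1) := by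
  intro h
  have hC := h229_C_eq N
  have hA : 0 < εC N * Real.exp 0 * 1 * (tgeometry 4 N).K₀ := by
    rw [K₀_four, Real.exp_zero, mul_one, mul_one]; exact mul_pos (εC_pos N) (K₀_pos 64 8)
  have hgt : 1 < Real.exp (εC N * Real.exp 0 * 1 * (tgeometry 4 N).K₀) := by
    have := Real.add_one_lt_exp hA.ne'; linarith
  have heq : Real.exp 1 * (tgeometry 4 N).K₀ * (tgeometry 4 N).c₁ *
      (εC N * Real.exp 0 * 1 * (tgeometry 4 N).K₀ * Real.exp (5 * RI N) * Real.exp (εC N * Real.exp 0 * 1 * (tgeometry 4 N).K₀)) =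
      Real.exp (εC N * Real.exp 0 * 1 * (tgeometry 4 N).K₀) := by
    rw [show Real.exp 1 * (tgeometry 4 N).K₀ * (tgeometry 4 N).c₁ *
      (εC N * Real.exp 0 * 1 * (tgeometry 4 N).K₀ * Real.exp (5 * RI N) * Real.exp (εC N * Real.exp 0 * 1 * (tgeometry 4 N).K₀)) =
      (Real.exp 1 * (tgeometry 4 N).K₀ * (tgeometry 4 N).c₁ * (εC N * Real.exp 0 * 1 * (tgeometry 4 N).K₀ * Real.exp (5 * RI N))) *
      Real.exp (εC N * Real.exp 0 * 1 * (tgeometry 4 N).K₀) by ring, hC, one_mul]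
  rw [heq] at h
  linarith

/-! ## §2 THE INNER DATA: NONEMPTY SETS of W53's ⟨component, label⟩ pairs, three per member -/

open Classical in
/-- THE INNER FINSETS (toy DATA): `JS Z′ :=` the NONEMPTY subsets of W53's `JC Z′` — LITERALLY the `J` S41.1 feeds to N0v's END at
`cl := id`, `I := univ`. [folklore] -/
def JS (Z' : TDom 4 N) : Finset (Finset (Σ _ : TDom 4 N, Bool)) := (JC N Z').powerset.filter fun T => T.Nonempty

open Classical in
/-- **THREE NONEMPTY SETS PER MEMBER**: `#JS Z′ = 2^2 − 1 = 3` (W53's `JC_card = 2`). [folklore] -/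
theorem JS_card (Z' : TDom 4 N) : (JS N Z').card = 3 := by
  unfold JS
  have h : ((JC N Z').powerset.filter fun T => T.Nonempty) = (JC N Z').powerset.erase ∅ := by
    ext T
    simp only [Finset.mem_filter, Finset.mem_erase, Finset.mem_powerset, Finset.nonempty_iff_ne_empty]
    tauto
  rw [h, Finset.card_erase_of_mem (Finset.mem_powerset.2 (Finset.empty_subset _)), Finset.card_powerset, JC_card]
  norm_num

/-- THE SET WEIGHT (toy DATA): `nS Z′ T := Π_{j∈T} εS·mC j.1 j.2` — LITERALLY S41.1's `n Z′ T`. [folklore] -/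
def nS (_Z' : TDom 4 N) (T : Finset (Σ _ : TDom 4 N, Bool)) : ℝ := ∏ j ∈ T, εS N * mC N j.1 j.2

/-- `0 ≤ nS`. [arith] -/
theorem nS_nonneg (Z' : TDom 4 N) (T : Finset (Σ _ : TDom 4 N, Bool)) : 0 ≤ nS N Z' T :=
  Finset.prod_nonneg fun _ _ => mul_nonneg (εS_pos N).le (mC_nonneg N _ _)

/-! ## §3 THE TERM INDEX OF RECORD (toy DATA): ALL admissible set-labelled outer labels — S41.1's `hadm` met -/

/-- The set-labelled outer labels `⟨W′, ⟨F, p⟩⟩`, `p Z′ _ ⊆ JC Z′` nonempty (S41.1's index type at `ι₀ := Bool`). [folklore] -/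
abbrev LabelS := Σ _ : Finset (TPt 4 N), Σ F : Finset (TDom 4 N), ∀ Z' ∈ F, Finset (Σ _ : TDom 4 N, Bool)

open Classical in
/-- THE TERM INDEXING OF RECORD (toy DATA): `W′ ⊆ cubes Z`, `F` a covering family of `cubes Z ∖ W′`, `p ∈ F.pi JS`. [folklore] -/
def termsS (Z : TDom 4 N) : Finset (LabelS N) :=
  ((tgeometry 4 N).cubes Z).powerset.sigma fun W =>
    (coveringFamilies (Finset.univ : Finset (TDom 4 N)) (tgeometry 4 N).cubes ((tgeometry 4 N).cubes Z \ W)).sigma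
      fun F => F.pi (JS N)

open Classical in
/-- **S41.1's `hadm` MET** (membership unpacking; the third clause = NONEMPTY ∧ SUBSET in S41.1's LITERAL shape). [folklore] -/
theorem hadm_S : ∀ Z : TDom 4 N, ∀ l ∈ termsS N Z, l.1 ⊆ (tgeometry 4 N).cubes Z ∧
    l.2.1 ∈ coveringFamilies Finset.univ (tgeometry 4 N).cubes ((tgeometry 4 N).cubes Z \ l.1) ∧
    ∀ Z' (h : Z' ∈ l.2.1), (l.2.2 Z' h).Nonempty ∧ l.2.2 Z' h ⊆
      ((Finset.univ : Finset (TDom 4 N)).filter (fun Z₀ => (fun Z : TDom 4 N => Z) Z₀ = Z')).sigma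
        (fun _ => (Finset.univ : Finset Bool)) := by
  intro Z l hl
  unfold termsS at hl
  obtain ⟨hW, hF⟩ := Finset.mem_sigma.1 hl
  obtain ⟨hF1, hp⟩ := Finset.mem_sigma.1 hF
  refine ⟨Finset.mem_powerset.1 hW, hF1, fun Z' h => ?_⟩
  have hT := Finset.mem_pi.1 hp Z' h
  unfold JS at hT
  obtain ⟨hsub, hne⟩ := Finset.mem_filter.1 hT
  exact ⟨hne, Finset.mem_powerset.1 hsub⟩

/-! ## §4 THE LABEL-INDEXED CORES (toy DATA): one W33 core per label, weighted by S41.1's majorant -/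

/-- S41.1's table-blind majorant of a label (toy DATA): `v^{#W′}·Π_{Z′∈F} Π_{j ∈ p Z′} εS·m j.1 j.2` — LITERALLY the shape in S41.1's
`hAmp`. [folklore] -/
def majS (l : LabelS N) : ℝ := vC N ^ l.1.card * ∏ x ∈ l.2.1.attach, ∏ j ∈ l.2.2 x.1 x.2, (εS N * mC N j.1 j.2)

/-- `0 ≤ maj`. [arith] -/
theorem majS_nonneg (l : LabelS N) : 0 ≤ majS N l :=
  mul_nonneg (pow_nonneg (vC_pos N).le _)
    (Finset.prod_nonneg fun _ _ => Finset.prod_nonneg fun _ _ => mul_nonneg (εS_pos N).le (mC_nonneg N _ _))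

variable (r : ℝ) (hr : 0 ≤ r)

/-- THE LABEL-DEPENDENT CAUCHY WEIGHT (toy DATA): `c l := (cM r∕2)·maj l` (W35's `cM` BY NAME). [folklore] -/
def cS (l : LabelS N) : ℝ := cM r / 2 * majS N l

/-- `0 ≤ c l`. [arith] -/
theorem cS_nonneg (l : LabelS N) : 0 ≤ cS N r l := mul_nonneg (half_pos (cM_pos r)).le (majS_nonneg N l)

/-- **THE LABEL-INDEXED CORE FAMILY** (toy DATA): at the label `l` W33's one-label core `coreW` (BY NAME) at the weight `c l`. [folklore] -/
def GS : ∀ (_ : ℕ) (_ : LabelS N), ℕ → BiCore toyFrame (fun _ : Unit => (0 : ℕ)) ℂ Unit E1 :=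
  fun _ l _ => coreW (cS N r l) r hr

/-- The core at `(k, l, X)`. [folklore] -/
@[simp] theorem GS_apply (k : ℕ) (l : LabelS N) (X : ℕ) : GS N r hr k l X = coreW (cS N r l) r hr := rfl

open Classical in
/-- THE ACTIVITY OF RECORD (toy DATA): the sum of the label-indexed cores' terms over ALL admissible set-labelled outer labels, along the
pencil `s ↦ 0 + s • liveTable` (S41.1's `hact`∕`hscale` by `rfl`, `emb Z := k`). [folklore] -/
def actS (k : ℕ) (s : ℂ) (Z : TDom 4 N) : ℂ :=
  ∑ l ∈ termsS N Z, (GS N r hr k l k).termAt (0 : ℂ) ((0 : B13HistM toyFrame) + s • liveTable)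

/-- **`hAmp` MET FOR EVERY SUB-POLYMER AND EVERY LABEL** [decided toy], in the LITERAL binder shape of S41.1 at NE5's toy letters
`(mq, bq, N₀) = (1, 0, 1)`, `ϱ = 2`, `A₀ = 0`, `A₁ = A∕4` (W35's `letterMass_coreW`, W41's `budget_half` BY NAME). [folklore] -/
theorem hAmp_S (k : ℕ) :
    ∀ Z : (tsys 4 N).Dom, (tgeometry 4 N).cubes Z ⊆ (tgeometry 4 N).cubes (X₀ N) → ∀ l ∈ termsS N Z,
      (GS N r hr k l k).lam.real univ *
          ((GS N r hr k l k).wB * (fun (_ : ℕ) (_ : LabelS N) (_ : ℕ) => (1 : ℝ)) k l k *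
            Real.exp ((fun (_ : ℕ) (_ : LabelS N) (_ : ℕ) => (0 : ℝ)) k l k)) *
          (Real.pi / ((fun (_ : ℕ) (_ : LabelS N) (_ : ℕ) => (1 : ℝ)) k l k / 2)) ^ (Module.finrank ℝ E1 / 2 : ℝ) *
        Real.exp ((GS N r hr k l k).N₁ * (‖(0 : B13HistM toyFrame)‖ + 2 * ‖liveTable‖)) ≤
      (0 + 2 * (Acst / 4)) * (vC N ^ l.1.card * ∏ x ∈ l.2.1.attach, ∏ j ∈ l.2.2 x.1 x.2, (εS N * mC N j.1 j.2)) := by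
  intro Z _ l _
  simp only [GS_apply]
  rw [letterMass_coreW, N₁_coreW, norm_zero, zero_add]
  have hp : 0 ≤ majS N l := majS_nonneg N l
  have hT : 2 * ‖liveTable‖ ≤ 2 := by linarith [norm_liveTable_le]
  have hb := budget_half r hr hT
  show |cS N r l| * Real.sqrt (2 * Real.pi) * Real.exp (r * (2 * ‖liveTable‖)) ≤ (0 + 2 * (Acst / 4)) * majS N l
  unfold cS
  rw [abs_mul, abs_of_nonneg hp]
  calc |cM r / 2| * majS N l * Real.sqrt (2 * Real.pi) * Real.exp (r * (2 * ‖liveTable‖))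
      = majS N l * (|cM r / 2| * Real.sqrt (2 * Real.pi) * Real.exp (r * (2 * ‖liveTable‖))) := by ring
    _ ≤ majS N l * (Acst / 2) := mul_le_mul_of_nonneg_left hb hp
    _ = (0 + 2 * (Acst / 4)) * majS N l := by ring

/-! ## §5 THE END FIRES: S41.1's set-labelled END applied ONCE BY NAME (a decided applier) -/

open Classical in
/-- **S41.1's `attachedPart_locE_le_of_coresAt_pencil_componentSets` FIRES** [decided toy]: both geometries the torus
`(tsys 4 N, tgeometry 4 N)`, closure `cl := id`, anchor `anc₁`, inner data `(univ : Finset Bool, mC)` (W53's, BY NAME), set amplitude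
`ε := εS`, cores `GS` indexed by ALL admissible set-labelled outer labels, W33's `ctr0`∕`hroom0`, NE5's toy letters INLINE, the pencil's
two radius inequalities, `hscale`∕`hact` by `rfl`, W24's `hrate_torus`, W45's `hsmall_F`∕`hκ_F`, W53's `hinner_C`∕`hanchor_C`∕`hA_C`∕
`htransfer_C`∕`hκR_C`∕`hrate2_C`∕`hRR_C`, §1's `h229_S`, `hlink := link_torus' 4 N` (S40.1 BY NAME), §3's `hadm_S`, §4's `hAmp_S`,
`hϱ : 2 ≤ 2`, `hϱA`.  Conclusion LITERAL. [folklore] -/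
theorem componentSetsEnd_fires (k : ℕ) :
    ‖locE (tgeometry 4 N).ι (tgeometry 4 N).cubes (actS N r hr k 1) ((tgeometry 4 N).cubes (X₀ N)) -
        locE (tgeometry 4 N).ι (tgeometry 4 N).cubes (actS N r hr k 0) ((tgeometry 4 N).cubes (X₀ N))‖ ≤
      4 * (Real.exp 1 * (tgeometry 4 N).ν * (tgeometry 4 N).c₁ * (tgeometry 4 N).K₀ ^ 2) * (Acst / 4) *
        Real.exp (-(0 * (tsys 4 N).dj (X₀ N))) :=
  attachedPart_locE_le_of_coresAt_pencil_componentSets (tsys 4 N) (tgeometry 4 N) (tgeometry 4 N) (GS N r hr)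
    (Win := Set.univ) (ctr := ctr0) (ROp := fun _ => 1) (RHist := fun _ => 2) (R' := fun _ => 2)
    (mq := fun _ _ _ => 1) (bq := fun _ _ _ => 0) (N₀ := fun _ _ _ => 1)
    hroom0 (fun _ _ _ _ _ _ _ => one_pos)
    (fun _ _ _ _ _ _ _ => ⟨fun _ _ => aestronglyMeasurable_const, fun _ => differentiableOn_const _, fun _ _ _ => by
      show ‖(1 : ℂ)‖ ≤ 1; rw [norm_one]⟩)
    (fun _ _ _ _ _ _ _ => ⟨fun _ _ => (Complex.measurable_ofReal.comp (measurable_snd.norm.pow_const 2)).aestronglyMeasurable,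
      fun _ _ => differentiableOn_const _, fun _ _ _ v => by
        show 1 * ‖v‖ ^ 2 - 0 ≤ (((‖v‖ ^ 2 : ℝ) : ℂ)).re; rw [Complex.ofReal_re]; simp⟩)
    (g := fun _ => 0) (Set.mem_univ _) (U := ()) (o := 0) (h₀ := 0) (w := liveTable) (ϱ := 2)
    (by show ‖(0 : ℂ) - 0‖ ≤ 1; simp)
    (by show ‖(0 : B13HistM toyFrame) - 0‖ + 2 * ‖liveTable‖ ≤ 2; rw [sub_zero, norm_zero, zero_add];
        linarith [norm_liveTable_le])
    (emb := fun _ => k) (fun _ => rfl) (terms := termsS N) (act := actS N r hr k) (fun _ _ _ => rfl)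
    (A₀ := 0) (A₁ := Acst / 4) (r₁ := 0) (b₅ := 0) (X₀ := X₀ N)
    le_rfl (by have := Acst_pos; positivity) le_rfl (by norm_num) (hrate_torus N) (hsmall_F N)
    (fun _ => (Finset.univ : Finset Bool)) (mC N) (mC_nonneg N) (fun Z : TDom 4 N => Z) (anc₁ N)
    (ε := εS N) (c₀ := 0) (R₀ := R₀C N) (Aₐ := 1) (ℓ := 1) (r := δF * κF) (R := RI N) (c' := 5) (v := vC N)
    (εS_pos N).le (vC_pos N).le (hinner_C N) (hanchor_C N) (hA_C N) (htransfer_C N) (hκR_C N) (hrate2_C N) (hκ_F N) (h229_S N)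
    (link_torus' 4 N) (hRR_C N) (hadm_S N) (hAmp_S N r hr k) le_rfl (by have := Acst_pos; linarith)

open Classical in
/-- … in CLOSED FORM: `≤ 4·(e·9·64·K₀(64,8)²)·(A∕4) = K₀(64,8)` (pv22's constants by `torus_consts`∕`K₀_four` BY NAME). [folklore] -/
theorem componentSetsEnd_fires_closed (k : ℕ) :
    ‖locE (tgeometry 4 N).ι (tgeometry 4 N).cubes (actS N r hr k 1) ((tgeometry 4 N).cubes (X₀ N)) -
        locE (tgeometry 4 N).ι (tgeometry 4 N).cubes (actS N r hr k 0) ((tgeometry 4 N).cubes (X₀ N))‖ ≤ K₀ 64 8 := by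
  refine (componentSetsEnd_fires N r hr k).trans (le_of_eq ?_)
  rw [(torus_consts N).1, (torus_consts N).2.2, K₀_four, zero_mul, neg_zero, Real.exp_zero, mul_one]
  unfold Acst
  have hK := K₀_pos (64 : ℝ) 8
  have he := Real.exp_pos 1
  field_simp

end Torus

end Summit.QuantumFields.BalabanUV.T4Continuum.NE1p.DressedSmallFieldComponentSetsWitness

end
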